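import Summits.QuantumFields.YangMills.Theorems.Instrument.ClosedComplexCountBound
import HarnessLib

/-!
# Instrument cell `ym-instrument`, crew (b): the DFS-contour (Friedli–Velenik Lemma 3.38) sharpening of the kernel lattice-animal tail —
# `#{connected (n+1)-sets through v} ≤ C(2n, n)·Δⁿ` generically, hence `closedCount 4 n ≤ 6·C(2n−2, n−1)·20^(n−1) ≤ 6·80^(n−1)`

QUESTIONS.md rows: Q-B1 (REGISTERED 2026-08-26T13:54:11Z; readings A-0826-8, A-0826-16); certs/b/FORMAT.md v1.4 §3b (`counts`/`tail` columns); cell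
`run/shared/lean/pub/ym-instrument/`, HUMAN RULING D-0084 (2), director-ym R138.  HONEST FRAMING (page 1, binding).  WHAT IS CERTIFIED HERE AND AT WHICH
`(G, D, L, β)`: PURE COMBINATORICS (no group, no coupling, no measure).  §1 is a GENERIC counting theorem for any type `V` with neighbour lists
`nbr x` of size `≤ Δ`: the finite sets `S ∋ v` of cardinality `n + 1` that are connected inside themselves from `v` number at most `C(2n, n)·Δⁿ ≤ (4Δ)ⁿ` —
the depth-first CONTOUR refinement of the tree's lazy-walk count `(Δ+1)^{2n}` (`Literature.Probability.LatticeModels.LatticeAnimals.card_connectedFamily_le`):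
a connected set is the vertex set of a push/pop code of length `2n` with exactly `n` pushes, each push choosing a listed neighbour of the current stack top
(existence by splicing `[push y, pop]` at a moment when the parent is on top — the splice argument of `LatticeAnimals.exists_lazyWalk_cover` with the return
step made free; first-exit lemma `LatticeAnimals.exists_step_out` BY NAME), and such codes number `≤ C(2n, n)·Δⁿ` (Pascal recursion).  §2 instantiates it on the
plaquettes of `ℤ⁴` with the share-a-link adjacency of the landed `ClosedComplexCountBound` (`Δ = 20`, six root plaquettes): ★ `closedCount 4 n ≤ 6·C(2n−2, n−1)·20^(n−1)`
for `n ≥ 1`, i.e. growth `80` per plaquette instead of `441`.  WHAT THIS IS FOR: the hypothesis-free typed Kotecký–Preiss window of the companion rows file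
moves from `β_W = 0.00165` (tail `6·441^{n−1}`, landed `KPCriterionSU2Unconditional`) to `≈ 0.0075` — still a NUMBER INSIDE `[0, 0.328)` (A-0826-16), a factor `6`
inside the certified-conditional `r★ = 0.047` (T2, counts) and a factor `38` inside the SC-c door `2/7`; it converts nothing but the typed constant.  NOT a
clustering statement, NOT a mass gap, NOT summit-bearing.  Grade (T): every statement below is a hypothesis-free kernel theorem.  (Librarian note: §1 is
model-independent and may be re-homed next to `LatticeAnimals`; [cite: FriedliVelenik2017, Lemma 3.38 and eq. (5.27)].)
-/

noncomputable section

open Finset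
open Literature.MathematicalPhysics.QuantumLattice (ZdEdge ZdPlaquette plaquetteEdges plaquettesTouching)
open Literature.MathematicalPhysics.QuantumFieldTheory (mem_plaquettesTouching_singleton card_plaquettesTouching_singleton_le)
open Literature.MathematicalPhysics.QuantumFieldTheory.Balaban1983to89.StrongCouplingKPWindow
  (links IsClosedComplex IsLinkConnected rootLink closedCount)
open Literature.Probability.LatticeModels (exists_step_out)
open Summit.QuantumFields.YangMills.Theorems.Instrument.ClosedComplexCountBound
  (nbr card_nbr_le_twenty adj_symm mem_nbr_of_adj reflTransGen_adj_of_isLinkConnected)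

namespace Summit.QuantumFields.YangMills.Theorems.Instrument.ClosedComplexCountDFSBound

/-! ## §1 Generic: push/pop (depth-first contour) codes of connected sets -/

section Generic

variable {V : Type*} [DecidableEq V] (nb : V → Finset V)

/-- A code is a list of moves `some y` (push the listed neighbour `y` of the current stack top) / `none` (pop).  `ValidFrom nb st c`: the code `c` is
executable from the stack `st` (every push is a listed neighbour of the top; pops are always allowed, idle on the empty stack). [folklore] -/
def ValidFrom : List V → List (Option V) → Prop
  | _, [] => True
  | st, none :: c => ValidFrom st.tail c
  | [], some _ :: _ => False
  | x :: st, some y :: c => y ∈ nb x ∧ ValidFrom (y :: x :: st) c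

/-- The stack after executing a code. [folklore] -/
def stackAfter : List V → List (Option V) → List V
  | st, [] => st
  | st, none :: c => stackAfter st.tail c
  | st, some y :: c => stackAfter (y :: st) c

omit [DecidableEq V] in
/-- `stackAfter` over a concatenation. [folklore] -/
theorem stackAfter_append (st : List V) (a b : List (Option V)) : stackAfter st (a ++ b) = stackAfter (stackAfter st a) b := by
  induction a generalizing st with
  | nil => rfl
  | cons m a ih =>
    cases m with
    | none => exact ih st.tail
    | some y => exact ih (y :: st)

omit [DecidableEq V] in
/-- Validity over a concatenation: valid from `st` on `a`, then valid from the resulting stack on `b`. [folklore] -/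
theorem validFrom_append {st : List V} {a b : List (Option V)} : ValidFrom nb st (a ++ b) ↔ ValidFrom nb st a ∧ ValidFrom nb (stackAfter st a) b := by
  induction a generalizing st with
  | nil => simp [ValidFrom, stackAfter]
  | cons m a ih =>
    cases m with
    | none =>
      simp only [List.cons_append, ValidFrom, stackAfter]
      exact ih
    | some y =>
      cases st with
      | nil => simp [ValidFrom]
      | cons x st =>
        simp only [List.cons_append, ValidFrom, stackAfter]
        rw [ih, and_assoc]

/-- The number of pushes of a code. [folklore] -/
def pushes (c : List (Option V)) : ℕ := (c.filterMap id).length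

/-- The decoded vertex set: the start vertex and every pushed vertex. [folklore] -/
def decode (v : V) (c : List (Option V)) : Finset V := insert v (c.filterMap id).toFinset

omit [DecidableEq V] in
/-- `pushes` is additive. [folklore] -/
theorem pushes_append (a b : List (Option V)) : pushes (a ++ b) = pushes a + pushes b := by
  simp [pushes, List.filterMap_append]

/-- ★ The finite set of valid codes of length `m` with exactly `k` pushes from the stack `st` (structural recursion on `m`). [folklore] -/
def codes : List V → ℕ → ℕ → Finset (List (Option V))
  | _, 0, 0 => {[]}
  | _, 0, _ + 1 => ∅
  | [], m + 1, k => (codes [] m k).image (List.cons none)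
  | _ :: st, m + 1, 0 => (codes st m 0).image (List.cons none)
  | x :: st, m + 1, k + 1 => (codes st m (k + 1)).image (List.cons none) ∪
      (nb x).biUnion fun y => (codes (y :: x :: st) m k).image (List.cons (some y))

/-- ★ **Counting codes (Pascal)**: `#codes st m k ≤ C(m, k)·Δᵏ` when every neighbour list has `≤ Δ` entries. [folklore] -/
theorem card_codes_le {Δ : ℕ} (hΔ : ∀ x, (nb x).card ≤ Δ) : ∀ (m : ℕ) (st : List V) (k : ℕ), (codes nb st m k).card ≤ m.choose k * Δ ^ k
  | 0, st, 0 => by simp [codes]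
  | 0, st, k + 1 => by simp [codes]
  | m + 1, [], k => by
    simp only [codes]
    refine card_image_le.trans ((card_codes_le hΔ m [] k).trans ?_)
    exact Nat.mul_le_mul_right _ (Nat.choose_le_choose k (Nat.le_succ m))
  | m + 1, x :: st, 0 => by
    simp only [codes]
    refine card_image_le.trans ((card_codes_le hΔ m st 0).trans ?_)
    simp
  | m + 1, x :: st, k + 1 => by
    simp only [codes]
    refine (card_union_le _ _).trans ?_
    have h1 : ((codes nb st m (k + 1)).image (List.cons none)).card ≤ m.choose (k + 1) * Δ ^ (k + 1) :=
      card_image_le.trans (card_codes_le hΔ m st (k + 1))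
    have h2 : ((nb x).biUnion fun y => (codes nb (y :: x :: st) m k).image (List.cons (some y))).card ≤ Δ * (m.choose k * Δ ^ k) :=
      (card_biUnion_le_card_mul _ _ _ fun y _ => card_image_le.trans (card_codes_le hΔ m _ k)).trans (Nat.mul_le_mul_right _ (hΔ x))
    calc _ ≤ m.choose (k + 1) * Δ ^ (k + 1) + Δ * (m.choose k * Δ ^ k) := Nat.add_le_add h1 h2
      _ = (m + 1).choose (k + 1) * Δ ^ (k + 1) := by rw [Nat.choose_succ_succ, pow_succ]; ring

/-- A valid code of length `m` with `k` pushes from `st` is listed in `codes st m k`. [folklore] -/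
theorem mem_codes {c : List (Option V)} : ∀ {st : List V} {m k : ℕ}, c.length = m → pushes c = k → ValidFrom nb st c → c ∈ codes nb st m k := by
  induction c with
  | nil =>
    intro st m k hl hp _
    simp only [List.length_nil] at hl
    simp only [pushes, List.filterMap_nil, List.length_nil] at hp
    subst hl; subst hp
    cases st <;> simp [codes]
  | cons mv c ih =>
    intro st m k hl hp hv
    obtain ⟨m', rfl⟩ : ∃ m', m = m' + 1 := ⟨c.length, by simpa using hl.symm⟩
    have hl' : c.length = m' := by simpa using hl
    cases mv with
    | none =>
      have hp' : pushes c = k := by simpa [pushes] using hp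
      have hv' : ValidFrom nb st.tail c := hv
      have hmem := ih hl' hp' hv'
      cases st with
      | nil => simp only [codes]; exact mem_image_of_mem _ hmem
      | cons x st =>
        cases k with
        | zero => simp only [codes]; exact mem_image_of_mem _ hmem
        | succ k => simp only [codes]; exact mem_union_left _ (mem_image_of_mem _ hmem)
    | some y =>
      cases st with
      | nil => exact absurd hv (by simp [ValidFrom])
      | cons x st =>
        obtain ⟨hy, hv'⟩ : y ∈ nb x ∧ ValidFrom nb (y :: x :: st) c := hv
        obtain ⟨k', rfl⟩ : ∃ k', k = k' + 1 := ⟨pushes c, by simpa [pushes] using hp.symm⟩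
        have hp' : pushes c = k' := by simpa [pushes] using hp
        have hmem := ih hl' hp' hv'
        simp only [codes]
        exact mem_union_right _ (mem_biUnion.2 ⟨y, hy, mem_image_of_mem _ hmem⟩)

/-- If `x` is decoded, the code splits at a moment when `x` is on top of the stack (start, or right after `x` is pushed). [folklore] -/
theorem exists_split_top {v x : V} {c : List (Option V)} (hx : x ∈ decode v c) :
    ∃ c₁ c₂ : List (Option V), ∃ rest : List V, c = c₁ ++ c₂ ∧ stackAfter [v] c₁ = x :: rest := by
  unfold decode at hx
  rcases mem_insert.1 hx with rfl | hx'
  · exact ⟨[], c, [], by simp, rfl⟩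
  · rw [List.mem_toFinset, List.mem_filterMap] at hx'
    obtain ⟨a, ha, hax⟩ := hx'
    have hax' : a = some x := by simpa using hax
    subst hax'
    obtain ⟨s, t, rfl⟩ := List.append_of_mem ha
    refine ⟨s ++ [some x], t, stackAfter [v] s, by simp, ?_⟩
    rw [stackAfter_append]
    rfl

/-- ★ **Covering codes.**  If every point of the finite set `S` is joined to `v ∈ S` by a chain of `R`-steps inside `S` (`nb` listing the `R`-neighbours),
then `S` is decoded by a valid push/pop code from `[v]` of length `2(#S − 1)` with `#S − 1` pushes. [folklore] -/
theorem exists_code_cover {R : V → V → Prop} (hnb : ∀ x y, R x y → y ∈ nb x) {S : Finset V} {v : V} (hv : v ∈ S)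
    (hS : ∀ w ∈ S, Relation.ReflTransGen (fun x y => R x y ∧ x ∈ S ∧ y ∈ S) v w) :
    ∃ c : List (Option V), c.length = 2 * (S.card - 1) ∧ pushes c = S.card - 1 ∧ ValidFrom nb [v] c ∧ decode v c = S := by
  have key : ∀ j, j + 1 ≤ S.card → ∃ T ⊆ S, v ∈ T ∧ T.card = j + 1 ∧
      ∃ c : List (Option V), c.length = 2 * j ∧ pushes c = j ∧ ValidFrom nb [v] c ∧ decode v c = T := by
    intro j
    induction j with
    | zero =>
      intro _
      exact ⟨{v}, by simpa using hv, mem_singleton_self v, card_singleton v, [], rfl, rfl, trivial, by simp [decode]⟩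
    | succ j ih =>
      intro hj
      obtain ⟨T, hTS, hvT, hTcard, c, hlen, hpush, hval, hdec⟩ := ih (by omega)
      obtain ⟨s, hsS, hsT⟩ : ∃ s ∈ S, s ∉ T := by
        by_contra h
        push Not at h
        have := card_le_card (show S ⊆ T from h)
        omega
      obtain ⟨x, y, hxT, hyT, hyS, hxy⟩ := exists_step_out (hS s hsS) hvT hsT
      have hxdec : x ∈ decode v c := hdec ▸ hxT
      obtain ⟨c₁, c₂, rest, rfl, htop⟩ := exists_split_top hxdec
      refine ⟨insert y T, insert_subset hyS hTS, mem_insert_of_mem hvT, by rw [card_insert_of_notMem hyT, hTcard],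
        c₁ ++ (some y :: none :: c₂), ?_, ?_, ?_, ?_⟩
      · simp only [List.length_append, List.length_cons] at hlen ⊢
        omega
      · rw [pushes_append] at hpush ⊢
        simp only [pushes, List.filterMap_cons] at hpush ⊢
        simp only [id, List.length_cons] at hpush ⊢
        omega
      · rw [validFrom_append] at hval ⊢
        refine ⟨hval.1, ?_⟩
        rw [htop] at hval ⊢
        exact ⟨hnb x y hxy, hval.2⟩
      · rw [← hdec]
        ext z
        simp only [decode, List.filterMap_append, List.filterMap_cons, id, mem_insert, List.mem_toFinset, List.mem_append, List.mem_cons]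
        tauto
  have hcard : 1 ≤ S.card := card_pos.2 ⟨v, hv⟩
  obtain ⟨T, hTS, -, hTcard, c, hlen, hpush, hval, hdec⟩ := key (S.card - 1) (by omega)
  have hTS' : T = S := eq_of_subset_of_card_le hTS (by omega)
  exact ⟨c, hlen, hpush, hval, hdec.trans hTS'⟩

/-- ★ **Counting connected sets through a point, contour form.**  Let `nb x` (`#nb x ≤ Δ`) list the `R`-neighbours of `x`.  Any finite family `𝒮` of finite
sets, each containing `v`, of cardinality exactly `n + 1` and `R`-connected inside itself from `v`, has at most `C(2n, n)·Δⁿ` members (vs the lazy-walk bound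
`(Δ+1)^{2n}` of `LatticeAnimals.card_connectedFamily_le`). [cite: FriedliVelenik2017, Lemma 3.38 and eq. (5.27)] -/
theorem card_connectedFamily_le_choose {R : V → V → Prop} {Δ : ℕ} (hΔ : ∀ x, (nb x).card ≤ Δ) (hnb : ∀ x y, R x y → y ∈ nb x)
    (v : V) (n : ℕ) (𝒮 : Finset (Finset V))
    (h𝒮 : ∀ S ∈ 𝒮, v ∈ S ∧ S.card = n + 1 ∧ ∀ w ∈ S, Relation.ReflTransGen (fun x y => R x y ∧ x ∈ S ∧ y ∈ S) v w) :
    𝒮.card ≤ (2 * n).choose n * Δ ^ n := by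
  have hsub : 𝒮 ⊆ (codes nb [v] (2 * n) n).image (decode v) := by
    intro S hS
    obtain ⟨hv, hcard, hconn⟩ := h𝒮 S hS
    obtain ⟨c, hlen, hpush, hval, hdec⟩ := exists_code_cover nb hnb hv hconn
    rw [hcard, Nat.add_sub_cancel] at hlen hpush
    exact mem_image.2 ⟨c, mem_codes nb hlen hpush hval, hdec⟩
  exact (card_le_card hsub).trans (card_image_le.trans (card_codes_le nb hΔ _ _ _))

end Generic

/-! ## §2 ★ Plaquettes of `ℤ⁴`: `closedCount 4 n ≤ 6·C(2n−2, n−1)·20^(n−1)` -/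

/-- The finite family containing every rooted link-connected `n`-complex: decoded push/pop codes of length `2(n−1)` with `n−1` pushes from one of the (at most
six) plaquettes through the root link. [folklore] -/
def dfsFamily (n : ℕ) : Finset (Finset (ZdPlaquette 4)) :=
  (plaquettesTouching {rootLink 4}).biUnion fun p => (codes nbr [p] (2 * (n - 1)) (n - 1)).image (decode p)

/-- Every link-connected `n`-complex through the root link belongs to `dfsFamily n`. [folklore] -/
theorem mem_dfsFamily {n : ℕ} {X : Finset (ZdPlaquette 4)} (hcard : X.card = n) (hroot : rootLink 4 ∈ links X)
    (hconn : IsLinkConnected X) : X ∈ dfsFamily n := by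
  unfold links at hroot
  obtain ⟨p, hpX, hpe⟩ := mem_biUnion.1 hroot
  have hS := reflTransGen_adj_of_isLinkConnected hconn hpX
  obtain ⟨c, hlen, hpush, hval, hdec⟩ := exists_code_cover nbr
    (R := fun x y : ZdPlaquette 4 => x ≠ y ∧ ¬ Disjoint (plaquetteEdges x) (plaquetteEdges y))
    (fun _ _ h => mem_nbr_of_adj h) hpX hS
  rw [hcard] at hlen hpush
  unfold dfsFamily
  exact mem_biUnion.2 ⟨p, mem_plaquettesTouching_singleton.2 hpe, mem_image.2 ⟨c, mem_codes nbr hlen hpush hval, hdec⟩⟩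

/-- `#dfsFamily n ≤ 6·C(2(n−1), n−1)·20^(n−1)`. [folklore] -/
theorem card_dfsFamily_le (n : ℕ) : (dfsFamily n).card ≤ 6 * ((2 * (n - 1)).choose (n - 1) * 20 ^ (n - 1)) := by
  unfold dfsFamily
  refine (card_biUnion_le_card_mul _ _ _ fun p _ => ?_).trans
    (Nat.mul_le_mul_right _ ((card_plaquettesTouching_singleton_le (rootLink 4)).trans (by norm_num)))
  exact card_image_le.trans (card_codes_le nbr card_nbr_le_twenty _ _ _)

/-- ★ **`closedCount 4 n ≤ 6·C(2n−2, n−1)·20^(n−1)` for every `n`** (DFS-contour tail of the tree's Kotecký–Preiss window; closedness unused). [folklore] -/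
theorem closedCount_four_le_choose (n : ℕ) : closedCount 4 n ≤ 6 * ((2 * (n - 1)).choose (n - 1) * 20 ^ (n - 1)) := by
  unfold closedCount
  have hsub : {X : Finset (ZdPlaquette 4) | X.card = n ∧ rootLink 4 ∈ links X ∧ IsLinkConnected X ∧ IsClosedComplex X} ⊆
      (↑(dfsFamily n) : Set (Finset (ZdPlaquette 4))) :=
    fun X hX => mem_coe.2 (mem_dfsFamily hX.1 hX.2.1 hX.2.2.1)
  calc Nat.card {X : Finset (ZdPlaquette 4) // X.card = n ∧ rootLink 4 ∈ links X ∧ IsLinkConnected X ∧ IsClosedComplex X}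
      = ({X : Finset (ZdPlaquette 4) | X.card = n ∧ rootLink 4 ∈ links X ∧ IsLinkConnected X ∧ IsClosedComplex X}).ncard :=
        Nat.card_coe_set_eq _
    _ ≤ (↑(dfsFamily n) : Set (Finset (ZdPlaquette 4))).ncard := Set.ncard_le_ncard hsub (finite_toSet _)
    _ = (dfsFamily n).card := Set.ncard_coe_finset _
    _ ≤ _ := card_dfsFamily_le n

/-- ★ Geometric form: `closedCount 4 n ≤ 6·80^(n−1)` for every `n` (Mathlib's `Nat.centralBinom_le_four_pow`). [folklore] -/
theorem closedCount_four_le_eighty (n : ℕ) : closedCount 4 n ≤ 6 * 80 ^ (n - 1) := by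
  refine (closedCount_four_le_choose n).trans ?_
  have h : (2 * (n - 1)).choose (n - 1) ≤ 4 ^ (n - 1) := by
    rw [← Nat.centralBinom_eq_two_mul_choose]; exact Nat.centralBinom_le_four_pow _
  calc 6 * ((2 * (n - 1)).choose (n - 1) * 20 ^ (n - 1)) ≤ 6 * (4 ^ (n - 1) * 20 ^ (n - 1)) :=
        Nat.mul_le_mul_left 6 (Nat.mul_le_mul_right _ h)
    _ = 6 * 80 ^ (n - 1) := by rw [← mul_pow]; norm_num

/-- ★ Real-valued form for the KP sum. [folklore] -/
theorem closedCount_four_le_choose_real (n : ℕ) :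
    (closedCount 4 n : ℝ) ≤ 6 * (((2 * (n - 1)).choose (n - 1) : ℕ) : ℝ) * (20 : ℝ) ^ (n - 1) := by
  have h := closedCount_four_le_choose n
  have h' : ((closedCount 4 n : ℕ) : ℝ) ≤ ((6 * ((2 * (n - 1)).choose (n - 1) * 20 ^ (n - 1)) : ℕ) : ℝ) := by exact_mod_cast h
  refine h'.trans (le_of_eq ?_)
  push_cast
  ring

end Summit.QuantumFields.YangMills.Theorems.Instrument.ClosedComplexCountDFSBound

end
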